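import Mathlib
import HarnessLib
import Summits.NavierStokesRegularity.NavierStokesRegularity.Theorems.CompletionRelayChainPhaseIEnclosure

/-!
# Route `CompletionRelayChain` — crux `RelayFrontStep` (stmt-NavierStokesRegularity-24850), K-side of `stub_phaseI`,
  work package K2(c)-iii: VECTOR-MATERIALISED JET LEVELS

`jetLevels`/`jet` (p623920) materialise each level through `materialize`, a `def` returning a closure; the compiler
arity-expands such a definition and re-evaluates the underlying `Vector.ofFn` at every access, which makes the compiled
recursion exponential in the level (measured on the farm).  This file gives the twin `jetLevelsV` whose levels are
`Vector` VALUES, and proves it computes the same thing (`jetV_eq`), so `jet_sound` transfers verbatim.  Nothing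
mathematical; MODEL-lattice bookkeeping (rung TL-M3-R64); nothing here is a statement about the Navier–Stokes equations.
-/

set_option linter.dupNamespace false

namespace Summit.NavierStokesRegularity.NavierStokesRegularity.Cruxes.RelayFrontStep.PhaseI

/-! ### Vector-materialised jets (same values as `jet`, p623920) -/

section JetsV

variable {β : Type} {n : ℕ}

/-- Total array read with default. [this file] -/
def agetV (A : Array (Vector β n)) (k : ℕ) (Y0 : Vector β n) : Vector β n := if h : k < A.size then A[k] else Y0

/-- Level `k+1` from `#[Y_0, …, Y_k]`, as a vector. [this file] -/
def jetNextV (o : EncOps β) (l : List (Fin n × Fin n × Fin n × ℚ × ℚ)) (Y0 : Vector β n)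
    (A : Array (Vector β n)) : Vector β n :=
  let k := A.size - 1
  Vector.ofFn fun c => o.post (o.divNat (k + 1)
    (sumR o (fun m =>
      let Um := agetV A m Y0
      let Vm := agetV A (k - m) Y0
      evalField o l (m == k - m) (fun a => Um[a]) (fun b => Vm[b]) c) (k + 1)))

/-- The levels `#[Y_0, …, Y_K]`, as vectors. [this file] -/
def jetLevelsV (o : EncOps β) (l : List (Fin n × Fin n × Fin n × ℚ × ℚ)) (Y0 : Vector β n) : ℕ → Array (Vector β n)
  | 0 => #[Y0]
  | K + 1 => let A := jetLevelsV o l Y0 K; A.push (jetNextV o l Y0 A)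

variable (o : EncOps β) (l : List (Fin n × Fin n × Fin n × ℚ × ℚ)) (Y0 : Vector β n)

/-- `jetLevelsV K` has `K+1` entries. [this file] -/
theorem size_jetLevelsV : ∀ K, (jetLevelsV o l Y0 K).size = K + 1
  | 0 => rfl
  | K + 1 => by simp [jetLevelsV, size_jetLevelsV K]

variable {o l Y0} in
/-- Reading below the old size ignores a push. [folklore] -/
theorem agetV_push_lt {A : Array (Vector β n)} {x : Vector β n} {k : ℕ} (hk : k < A.size) :
    agetV (A.push x) k Y0 = agetV A k Y0 := by
  unfold agetV
  rw [dif_pos (by rw [Array.size_push]; omega), dif_pos hk, Array.getElem_push_lt]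

variable {o l Y0} in
/-- Reading at the old size returns the pushed entry. [folklore] -/
theorem agetV_push_size {A : Array (Vector β n)} {x : Vector β n} : agetV (A.push x) A.size Y0 = x := by
  unfold agetV
  rw [dif_pos (by rw [Array.size_push]; omega), Array.getElem_push_eq]

/-- `sumR` only reads `f` below `k`. [this file] -/
theorem sumR_congr {f g : ℕ → β} : ∀ k, (∀ m < k, f m = g m) → sumR o f k = sumR o g k
  | 0, _ => rfl
  | k + 1, hfg => by
    simp only [sumR]
    rw [sumR_congr k fun m hm => hfg m (Nat.lt_succ_of_lt hm), hfg k (Nat.lt_succ_self k)]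

/-- Unfolding of `jetLevelsV (K+1)`. [this file] -/
theorem jetLevelsV_succ (K : ℕ) :
    jetLevelsV o l Y0 (K + 1) = (jetLevelsV o l Y0 K).push (jetNextV o l Y0 (jetLevelsV o l Y0 K)) := rfl

/-- **The vector levels are the levels of `jet`** (p623920), read through `Y0[·]` (diagonal form). [this file] -/
theorem jetV_eq : ∀ (K k : ℕ), k ≤ K → ∀ c : Fin n,
    (agetV (jetLevelsV o l Y0 K) k Y0)[c] = jet o l (fun c => Y0[c]) k k c
  | 0, k, hk, c => by
    obtain rfl := Nat.le_zero.1 hk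
    simp [agetV, jetLevelsV, jet, aget, jetLevels]
  | K + 1, k, hk, c => by
    rcases Nat.lt_or_eq_of_le hk with hlt | rfl
    · have hkK : k ≤ K := Nat.lt_succ_iff.1 hlt
      rw [jetLevelsV_succ, agetV_push_lt (by rw [size_jetLevelsV]; exact hlt)]
      exact jetV_eq K k hkK c
    · have hget := @agetV_push_size β n Y0 (jetLevelsV o l Y0 K) (jetNextV o l Y0 (jetLevelsV o l Y0 K))
      rw [size_jetLevelsV] at hget
      rw [jet_succ, jetLevelsV_succ, hget]
      simp only [jetNextV, size_jetLevelsV, Nat.add_sub_cancel, Fin.getElem_fin, Vector.getElem_ofFn, Fin.eta]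
      have hs : sumR o (fun m => evalField o l (m == K - m) (fun a => (agetV (jetLevelsV o l Y0 K) m Y0)[a])
            (fun b => (agetV (jetLevelsV o l Y0 K) (K - m) Y0)[b]) c) (K + 1) =
          sumR o (fun m => evalField o l (m == K - m) (jet o l (fun c => Y0[c]) K m)
            (jet o l (fun c => Y0[c]) K (K - m)) c) (K + 1) := by
        refine sumR_congr o (K + 1) fun m hm => ?_
        have hmK : m ≤ K := Nat.le_of_lt_succ hm
        have h1 : (fun a => (agetV (jetLevelsV o l Y0 K) m Y0)[a]) = jet o l (fun c => Y0[c]) K m :=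
          funext fun a => by rw [jet_of_le o l _ hmK]; exact jetV_eq K m hmK a
        have h2 : (fun b => (agetV (jetLevelsV o l Y0 K) (K - m) Y0)[b]) = jet o l (fun c => Y0[c]) K (K - m) :=
          funext fun b => by rw [jet_of_le o l _ (Nat.sub_le K m)]; exact jetV_eq K (K - m) (Nat.sub_le K m) b
        rw [h1, h2]
      simp only [Fin.getElem_fin] at hs
      rw [hs]

end JetsV

end Summit.NavierStokesRegularity.NavierStokesRegularity.Cruxes.RelayFrontStep.PhaseI
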